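import Literature.AnabelianGeometry.SemiGraphs.SubgraphComponentsDoubleCosetsOfDetectedOver
import Literature.AnabelianGeometry.SemiGraphs.SubgraphComponentsDoubleCosetsOfEssentialCells
import HarnessLib

/-!
# (D3) `covering_subgraphComponents_doubleCosets` WITHOUT branch alignment — CLASS CLOSERS over CLOSED edge-cells only ([SemiAnbd] Cor. 2.7 (i) p. 30)

Mochizuki, *Semi-graphs of anabelioids*, Publ. RIMS **42** (2006), §2, proof of Cor. 2.7 (i) p. 30
("[as one verifies immediately] `ℋ′` injects into `𝒢′` as a subgraph"; the two sheets `ℋ″`, `g · ℋ″`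
of a connected finite Galois étale covering) [cite: MochizukiSemiAnbd2006, Cor. 2.7(i) p.30]; Def. 2.2 (i)
p. 23, Rem. 2.2.1 p. 24.

PROOF-ONLY (abc-iut cell, layer L3; FACT-LIST row F-1487 `covering_subgraphComponents_doubleCosets`
AS TYPED — local ∧ global ∧ vertex-aligned, NO branch alignment —, CLASS route «regluing invisibility»
of abc-iut-w4-d080, brick R6c «LOCALISED TIE», file E2d = the closers; seat abc-iut-f-161 (gen 13),
L3-lead ζ3; SHAPES `HOME/staging/f/f-161/g13/SHAPES-R6c.md`).  The sub-graph `ℍ` of (D3) is a GRAPH,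
so its edges are CLOSED in `𝔾`; by E2c (`covering_subgraphComponents_doubleCosets_of_sectionE_surjectiveOn`)
only the cells of `𝔾_A` over `ℍ.edges` have to be detected.  Hence the port-class closer (B3) and the
assembled class closer (E1) hold with their per-cell hypothesis asked ONLY AT CLOSED EDGES of `𝔾`:

* `covering_subgraphComponents_doubleCosets_of_closedPorts` — B3's
  `covering_subgraphComponents_doubleCosets_of_connectedPorts` with the port asked only for the edge-cells
  over closed edges (a port detects its cell, `Hom.sectionE_detected_of_port`);
* `covering_subgraphComponents_doubleCosets_of_closedEssentialCells` — **THE CLASS CLOSER over CLOSED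
  cells: the body of F-1487 AS TYPED for EVERY covering of every connected `(𝒢, A)` each of whose
  edge-cells OVER A CLOSED EDGE is either carried by a two-sided non-separating branch-cell of `𝔾_A`
  or essential on both sides** (E1's per-cell producers `BObj.port_of_nonSeparating_cell`,
  `BObj.port_of_essential`).  OPEN edge-cells (cusps) no longer constrain the class.

What is NOT here: separating closed cells with an inessential (HAIR) side (R7).
Consolidation TODO (not tonight, abc-iut-L3-lead ζ11): the tree's global theorems are the
`S = univ` + connected corollaries of the `…_of_closed…` forms here (the tree's being B3's `…_of_connectedPorts`, E1's `…_of_essentialCells`) and could be re-derived from them.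
CLASS-route closers:
F-1487 AS TYPED stays OPEN-AS-TYPED (L3-lead δ22); CLASS CLOSER ≠ the fact; typed ≠ proved; no
definition, no instance, no new named fact; nothing here takes a side on [IUTchIII] Cor. 3.12.
-/

namespace Literature.AnabelianGeometry.SemiGraphs

namespace SemiGraphOfAnabelioids

open CategoryTheory CategoryTheory.Limits CategoryTheory.Functor CategoryTheory.PreGaloisCategory
open Literature.AnabelianGeometry.Anabelioids
open scoped Pointwise

universe v₁ u₁ u

variable {𝒢 𝒢' : SemiGraphOfAnabelioids.{v₁, u₁, u}}

/-- **The edges of a sub-GRAPH are closed**: if `ℍ ⊆ 𝔾` is a graph (every branch of `ℍ` abuts in `ℍ`),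
every branch of `𝔾` on an edge of `ℍ` abuts to a vertex. [cite: MochizukiSemiAnbd2006, §1 p.11] -/
theorem isSome_abuts_of_mem_edges (H : 𝒢.graph.Subgraph) (hHg : H.toSemiGraph.IsGraph)
    {e : 𝒢.graph.Edge} (he : e ∈ H.edges) (b : 𝒢.graph.Branch) (hb : 𝒢.graph.edgeOf b = e) :
    (𝒢.graph.abuts b).isSome := by
  obtain ⟨w, hw⟩ := Option.isSome_iff_exists.mp (hHg.abuts_isSome ⟨b, hb ▸ he⟩)
  exact Option.isSome_iff_exists.mpr ⟨w.1, (SemiGraph.Subgraph.abuts_eq_some_iff H _ _).mp hw⟩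

/-- **THE PORT-CLASS CLOSER over CLOSED cells** ([SemiAnbd] Cor. 2.7 (i) p. 30 at the TYPED notion of
morphism: local ∧ global ∧ vertex-aligned, NO branch alignment).  As B3's
`covering_subgraphComponents_doubleCosets_of_connectedPorts`, but the PORT (a connected `Y → A` and a
two-sided non-separating branch-cell of `𝔾_Y` over a branch of `e` whose component maps into `Q`) is
asked ONLY for the edge-cells `(e, Q)` over CLOSED edges `e` of `𝔾` (both branches abut).  Proof: the
edges of the sub-graph `ℍ` of (D3) are closed (`isSome_abuts_of_mem_edges`), a port detects its cell
(`Hom.sectionE_detected_of_port`), then E2c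
`covering_subgraphComponents_doubleCosets_of_sectionE_surjectiveOn`.  CLASS CLOSER only: the typed fact
is not asserted. [cite: MochizukiSemiAnbd2006, Cor. 2.7(i) p.30] -/
theorem covering_subgraphComponents_doubleCosets_of_closedPorts :
    ∀ (𝒢 𝒢' : SemiGraphOfAnabelioids.{v₁, u₁, u}) (φ : Hom 𝒢' 𝒢) (A : 𝒢.BObj),
      𝒢.IsConnected → 𝒢'.IsConnected → φ.IsFiniteEtaleCoveringOf A → φ.IsGlobalCoveringOf A →
      φ.IsVertexAligned →
      (∀ (e : 𝒢.graph.Edge), (∀ b : 𝒢.graph.Branch, 𝒢.graph.edgeOf b = e → (𝒢.graph.abuts b).isSome) →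
        ∀ (Q : π₀Obj (A.T e)),
        ∃ (Y : 𝒢.BObj) (_ : PreGaloisCategory.IsConnected Y) (g : Y ⟶ A)
          (bc : Y.fibreData.total.Branch) (vc₀ vc₁ : Y.fibreData.total.Vertex)
          (bc₁ : Y.fibreData.total.Branch),
          Y.fibreData.total.abuts bc = some vc₀ ∧ Y.fibreData.total.abuts bc₁ = some vc₁ ∧
          bc₁ ≠ bc ∧ Y.fibreData.total.edgeOf bc₁ = Y.fibreData.total.edgeOf bc ∧
          Relation.ReflTransGen
            (fun x y : Y.fibreData.total.Vertex => ∃ b b' : Y.fibreData.total.Branch,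
              b ≠ bc ∧ b' ≠ bc ∧ Y.fibreData.total.edgeOf b = Y.fibreData.total.edgeOf b' ∧
                Y.fibreData.total.abuts b = some x ∧ Y.fibreData.total.abuts b' = some y) vc₀ vc₁ ∧
          ∃ (Q' : π₀Obj (A.T (𝒢.graph.edgeOf (Y.fibreData.proj.branchMap bc)))),
            (⟨𝒢.graph.edgeOf (Y.fibreData.proj.branchMap bc), Q'⟩ : Σ e, π₀Obj (A.T e)) = ⟨e, Q⟩ ∧
            ∃ k : ((Y.brComp bc).1 : 𝒢.E (𝒢.graph.edgeOf (Y.fibreData.proj.branchMap bc))) ⟶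
                (Q'.1 : 𝒢.E (𝒢.graph.edgeOf (Y.fibreData.proj.branchMap bc))),
              k ≫ Q'.1.arrow =
                (Y.brComp bc).1.arrow ≫ g.fT (𝒢.graph.edgeOf (Y.fibreData.proj.branchMap bc))) →
      ∀ (v' : 𝒢'.graph.Vertex) (F' : 𝒢'.V v' ⥤ FintypeCat.{v₁}) [FiberFunctor F']
        (F : 𝒢.V (φ.base.vertexMap v') ⥤ FintypeCat.{v₁}) [FiberFunctor F]
        (e : (φ.φV v').pullback ⋙ F' ≅ F)
        (H : 𝒢.graph.Subgraph), H.toSemiGraph.IsConnected → H.toSemiGraph.IsGraph →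
        ∀ (hv : φ.base.vertexMap v' ∈ H.verts),
        let v := φ.base.vertexMap v'
        let ι : 𝒢'.Pi v' F' →* 𝒢.Pi v F :=
          (Aut.autMulEquivOfIso (Functor.isoWhiskerLeft (𝒢.ρ v) e)).toMonoidHom.comp
            (pi1Map φ.pullbackFunctor (𝒢'.ρ v' ⋙ F'))
        let PH : Subgroup (𝒢.Pi v F) := (𝒢.piHToPi H ⟨v, hv⟩ F).range
        ∀ x₀ : (𝒢.ρ v ⋙ F).obj A, ι.range = MulAction.stabilizer (𝒢.Pi v F) x₀ →
          ∃ d : {K : 𝒢'.graph.Subgraph // φ.IsPreimageComponent H K} → 𝒢.Pi v F,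
            Function.Bijective (fun K => DoubleCoset.mk PH ι.range (d K)) ∧
            (∃ K₀ : {K : 𝒢'.graph.Subgraph // φ.IsPreimageComponent H K}, v' ∈ K₀.1.verts) ∧
            (∀ (K : {K : 𝒢'.graph.Subgraph // φ.IsPreimageComponent H K}) (hK : v' ∈ K.1.verts),
              d K ∈ ι.range ∧ (ι.comp (𝒢'.piHToPi K.1 ⟨v', hK⟩ F')).range = ι.range ⊓ PH) ∧
            ∀ (K : {K : 𝒢'.graph.Subgraph // φ.IsPreimageComponent H K})
              (w'' : K.1.toSemiGraph.Vertex) (F'' : 𝒢'.V w''.1 ⥤ FintypeCat.{v₁}) [FiberFunctor F'']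
              (α : 𝒢'.ρ w''.1 ⋙ F'' ≅ 𝒢'.ρ v' ⋙ F'),
              ∃ g : 𝒢.Pi v F,
                (ι.comp ((Aut.autMulEquivOfIso α).toMonoidHom.comp (𝒢'.piHToPi K.1 w'' F''))).range =
                  ι.range ⊓ ConjAct.toConjAct g⁻¹ • PH := by
  intro 𝒢 𝒢' φ A h𝒢 h𝒢' hloc hB hva hport v' F' _ F _ e H hH hHg hv v ι PH x₀ hx₀
  obtain ⟨hprod, α, hα, ⟨eB⟩⟩ := hB
  haveI := hprod
  haveI := hα
  refine covering_subgraphComponents_doubleCosets_of_sectionE_surjectiveOn φ A α eB h𝒢 h𝒢' hloc hva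
    v' F' F e H hH hHg hv ?_ x₀ hx₀
  intro e₁ he₁ Q
  obtain ⟨Y, hY, g, bc, vc₀, vc₁, bc₁, h₀, h₁, hne, he, hreach, Q₁, hQ₁, hcQ⟩ :=
    hport e₁ (𝒢.isSome_abuts_of_mem_edges H hHg he₁) Q
  letI := 𝒢.galoisCategory_bObj h𝒢
  haveI := hY
  obtain ⟨e', Q', hQ', hk⟩ := φ.sectionE_detected_of_port A α eB g
    (fun u _ => Anabelioids.isIso_of_isConnected_of_endo u) bc h₀ h₁ hne he hreach Q₁ hcQ
  exact ⟨e', Q', hQ'.trans hQ₁, hk⟩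

/-- **THE CLASS CLOSER over CLOSED cells, ASSEMBLED — (D3) AS TYPED over bases each of whose CLOSED
edge-cells is non-separating or essential on both sides** ([SemiAnbd] Cor. 2.7 (i) p. 30, "`ℋ′` injects
into `𝒢′` as a subgraph"; Def. 2.2 (i) p. 23 at the TYPED notion of morphism: local ∧ global ∧
vertex-aligned, NO branch alignment).  As E1's `covering_subgraphComponents_doubleCosets_of_essentialCells`,
but the per-cell disjunction — (NS) the cell is carried by a two-sided NON-SEPARATING branch-cell of
`𝔾_A`, or (ESS) `e = {b₀, b₁}` and in frames `(v₁, F₁, F_e, α₁)`, `(v₂, F₂, F_e′, α₂)` points `a₁`, `a₂`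
over the cell at which the respective side is ESSENTIAL — is asked ONLY for the edge-cells over CLOSED
edges of `𝔾`.  Consequently OPEN edge-cells (cusps) no longer constrain the class; the residual is a
separating closed cell with an inessential (HAIR) side.  Proof: per cell, (NS) ⇒ the trivial port
(`BObj.port_of_nonSeparating_cell`), (ESS) ⇒ R6a `BObj.port_of_essential`; then
`covering_subgraphComponents_doubleCosets_of_closedPorts`.  CLASS CLOSER only: the typed fact, which
quantifies over all `(𝒢, A)`, is not asserted. [cite: MochizukiSemiAnbd2006, Cor. 2.7(i) p.30] -/

theorem covering_subgraphComponents_doubleCosets_of_closedEssentialCells :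
    ∀ (𝒢 𝒢' : SemiGraphOfAnabelioids.{v₁, u₁, u}) (φ : Hom 𝒢' 𝒢) (A : 𝒢.BObj),
      𝒢.IsConnected → 𝒢'.IsConnected → φ.IsFiniteEtaleCoveringOf A → φ.IsGlobalCoveringOf A →
      φ.IsVertexAligned →
      (∀ (e : 𝒢.graph.Edge), (∀ b : 𝒢.graph.Branch, 𝒢.graph.edgeOf b = e → (𝒢.graph.abuts b).isSome) →
        ∀ (Q : π₀Obj (A.T e)),
        (∃ (bc₀ : A.fibreData.total.Branch) (vc₀ vc₁ : A.fibreData.total.Vertex)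
            (bc₁ : A.fibreData.total.Branch),
          (⟨𝒢.graph.edgeOf (A.fibreData.proj.branchMap bc₀), A.brComp bc₀⟩ : Σ e, π₀Obj (A.T e)) =
            ⟨e, Q⟩ ∧
          A.fibreData.total.abuts bc₀ = some vc₀ ∧ A.fibreData.total.abuts bc₁ = some vc₁ ∧
          bc₁ ≠ bc₀ ∧ A.fibreData.total.edgeOf bc₁ = A.fibreData.total.edgeOf bc₀ ∧
          Relation.ReflTransGen
            (fun x y : A.fibreData.total.Vertex => ∃ bc bc' : A.fibreData.total.Branch,
              bc ≠ bc₀ ∧ bc' ≠ bc₀ ∧ A.fibreData.total.edgeOf bc = A.fibreData.total.edgeOf bc' ∧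
                A.fibreData.total.abuts bc = some x ∧ A.fibreData.total.abuts bc' = some y) vc₀ vc₁) ∨
        (∃ (v₁ : 𝒢.graph.Vertex) (F₁ : 𝒢.V v₁ ⥤ FintypeCat.{v₁}) (_ : FiberFunctor F₁)
            (b₀ : 𝒢.graph.Branch) (h₀ : 𝒢.graph.abuts b₀ = some v₁)
            (Fe : 𝒢.E (𝒢.graph.edgeOf b₀) ⥤ FintypeCat.{v₁}) (_ : FiberFunctor Fe)
            (α₁ : (𝒢.pull b₀ v₁ h₀).pullback ⋙ Fe ≅ F₁) (Q₀ : π₀Obj (A.T (𝒢.graph.edgeOf b₀)))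
            (_ : (⟨𝒢.graph.edgeOf b₀, Q₀⟩ : Σ e, π₀Obj (A.T e)) = ⟨e, Q⟩)
            (a₁ : F₁.obj (A.S v₁))
            (_ : Fe.map (A.ψ b₀ v₁ h₀).hom (α₁.inv.app (A.S v₁) a₁) ∈ Set.range (Fe.map Q₀.1.arrow))
            (_ : ∃ u : 𝒢.PiV v₁ F₁, u • a₁ = a₁ ∧
              𝒢.piVToPi v₁ F₁ u ∉ (𝒢.branchSubgroup F₁ b₀ h₀ Fe α₁).map (𝒢.piVToPi v₁ F₁))
            (v₂ : 𝒢.graph.Vertex) (F₂ : 𝒢.V v₂ ⥤ FintypeCat.{v₁}) (_ : FiberFunctor F₂)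
            (b₁ : 𝒢.graph.Branch) (_ : b₁ ≠ b₀) (h₁ : 𝒢.graph.abuts b₁ = some v₂)
            (Fe' : 𝒢.E (𝒢.graph.edgeOf b₁) ⥤ FintypeCat.{v₁}) (_ : FiberFunctor Fe')
            (α₂ : (𝒢.pull b₁ v₂ h₁).pullback ⋙ Fe' ≅ F₂) (Q₁ : π₀Obj (A.T (𝒢.graph.edgeOf b₁)))
            (_ : (⟨𝒢.graph.edgeOf b₁, Q₁⟩ : Σ e, π₀Obj (A.T e)) = ⟨𝒢.graph.edgeOf b₀, Q₀⟩)
            (a₂ : F₂.obj (A.S v₂))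
            (_ : Fe'.map (A.ψ b₁ v₂ h₁).hom (α₂.inv.app (A.S v₂) a₂) ∈ Set.range (Fe'.map Q₁.1.arrow)),
            ∃ u : 𝒢.PiV v₂ F₂, u • a₂ = a₂ ∧
              𝒢.piVToPi v₂ F₂ u ∉ (𝒢.branchSubgroup F₂ b₁ h₁ Fe' α₂).map (𝒢.piVToPi v₂ F₂))) →
      ∀ (v' : 𝒢'.graph.Vertex) (F' : 𝒢'.V v' ⥤ FintypeCat.{v₁}) [FiberFunctor F']
        (F : 𝒢.V (φ.base.vertexMap v') ⥤ FintypeCat.{v₁}) [FiberFunctor F]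
        (e : (φ.φV v').pullback ⋙ F' ≅ F)
        (H : 𝒢.graph.Subgraph), H.toSemiGraph.IsConnected → H.toSemiGraph.IsGraph →
        ∀ (hv : φ.base.vertexMap v' ∈ H.verts),
        let v := φ.base.vertexMap v'
        let ι : 𝒢'.Pi v' F' →* 𝒢.Pi v F :=
          (Aut.autMulEquivOfIso (Functor.isoWhiskerLeft (𝒢.ρ v) e)).toMonoidHom.comp
            (pi1Map φ.pullbackFunctor (𝒢'.ρ v' ⋙ F'))
        let PH : Subgroup (𝒢.Pi v F) := (𝒢.piHToPi H ⟨v, hv⟩ F).range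
        ∀ x₀ : (𝒢.ρ v ⋙ F).obj A, ι.range = MulAction.stabilizer (𝒢.Pi v F) x₀ →
          ∃ d : {K : 𝒢'.graph.Subgraph // φ.IsPreimageComponent H K} → 𝒢.Pi v F,
            Function.Bijective (fun K => DoubleCoset.mk PH ι.range (d K)) ∧
            (∃ K₀ : {K : 𝒢'.graph.Subgraph // φ.IsPreimageComponent H K}, v' ∈ K₀.1.verts) ∧
            (∀ (K : {K : 𝒢'.graph.Subgraph // φ.IsPreimageComponent H K}) (hK : v' ∈ K.1.verts),
              d K ∈ ι.range ∧ (ι.comp (𝒢'.piHToPi K.1 ⟨v', hK⟩ F')).range = ι.range ⊓ PH) ∧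
            ∀ (K : {K : 𝒢'.graph.Subgraph // φ.IsPreimageComponent H K})
              (w'' : K.1.toSemiGraph.Vertex) (F'' : 𝒢'.V w''.1 ⥤ FintypeCat.{v₁}) [FiberFunctor F'']
              (α : 𝒢'.ρ w''.1 ⋙ F'' ≅ 𝒢'.ρ v' ⋙ F'),
              ∃ g : 𝒢.Pi v F,
                (ι.comp ((Aut.autMulEquivOfIso α).toMonoidHom.comp (𝒢'.piHToPi K.1 w'' F''))).range =
                  ι.range ⊓ ConjAct.toConjAct g⁻¹ • PH := by
  intro 𝒢 𝒢' φ A h𝒢 h𝒢' hloc hB hva hcells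
  refine covering_subgraphComponents_doubleCosets_of_closedPorts 𝒢 𝒢' φ A h𝒢 h𝒢' hloc hB hva ?_
  -- `A` is connected (the global clause, (D8) direction `𝒢′` connected ⇒ `A` connected)
  have hA : PreGaloisCategory.IsConnected A := isConnected_of_isGlobalCovering h𝒢' φ A hB
  letI := 𝒢.galoisCategory_bObj h𝒢
  intro e hcl Q
  rcases hcells e hcl Q with
    ⟨bc₀, vc₀, vc₁, bc₁, hcell, h₀, h₁, hne, he, hreach⟩ |
    ⟨v₁, F₁, hF₁, b₀, h₀, Fe, hFe, α₁, Q₀, hQ₀, a₁, ha₁, hess₀, v₂, F₂, hF₂, b₁, hb, h₁, Fe', hFe', α₂,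
      Q₁, hQ₁, a₂, ha₂, hess₁⟩
  · -- (NS): the trivial port `(A, 𝟙_A)` at the cell itself
    obtain ⟨Y, hY, g, bc, wc₀, wc₁, bc', h₀', h₁', hne', he', hreach', Q', hQ', hk⟩ :=
      BObj.port_of_nonSeparating_cell A hA bc₀ h₀ h₁ hne he hreach
    exact ⟨Y, hY, g, bc, wc₀, wc₁, bc', h₀', h₁', hne', he', hreach', Q', hQ'.trans hcell, hk⟩
  · -- (ESS): R6a, a port at a Galois level
    haveI := hF₁; haveI := hFe; haveI := hF₂; haveI := hFe'
    haveI : FiberFunctor (𝒢.ρ v₁ ⋙ F₁) := 𝒢.fiberFunctor_ρ h𝒢 v₁ F₁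
    haveI : FiberFunctor (𝒢.ρ v₂ ⋙ F₂) := 𝒢.fiberFunctor_ρ h𝒢 v₂ F₂
    obtain ⟨Y, hY, g, bc, wc₀, wc₁, bc', h₀', h₁', hne', he', hreach', Q', hQ', hk⟩ :=
      BObj.port_of_essential h𝒢 A F₁ b₀ h₀ Fe α₁ Q₀ a₁ ha₁ hess₀ F₂ b₁ hb h₁ Fe' α₂ Q₁ hQ₁ a₂ ha₂ hess₁
    exact ⟨Y, hY, g, bc, wc₀, wc₁, bc', h₀', h₁', hne', he', hreach', Q', hQ'.trans hQ₀, hk⟩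

end SemiGraphOfAnabelioids

end Literature.AnabelianGeometry.SemiGraphs
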